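import Literature.Analysis.FluidPDE.LocalPressureOscillationSlab
import Literature.Analysis.FluidPDE.LocalLerayPressureDecompositionProofs
import HarnessLib

/-!
# The local pressure expansion on a time slice: the regularised near field converges to the
Riesz-transform pressure, and the slice representation `p = p̃[1_{B_{2r}} w] + p_far + κ`
(Kang–Miura–Tsai 2021, Lemma 3.4, slice form)

Analysis/FluidPDE support file (theorems only, everything PROVED, no definitions, no named facts)
on the discharge path of the named fact
`Literature.Analysis.FluidPDE.kangMiuraTsai_pressure_decomposition` (**PD**,
`LocalLerayPressureDecomposition.lean`; Kang–Miura–Tsai, IMRN 2021 = arXiv:1812.10509,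
**Lemma 3.4** (pressure decomposition), p. 8: for a local Leray solution `(v, π)`,
`π = π_loc + π_far + c_{x₀,r}(t)` on `B_r(x₀) × (0,T)` with
`π_loc = -|v|²/3 + p.v.∫_{B_{2r}(x₀)} K(x-y):(v ⊗ v) dy`,
`π_far = ∫_{|y-x₀|≥2r} (K(x-y) - K(x₀-y)):(v ⊗ v) dy`; proof §8 pp. 17–18).

The tree's Liouville step (`LocalPressureLiouville.lean`,
`IsLocalLeraySolutionOn.ae_slice_pgIdentity`) gives on a.e. time slice `(w, p) = (v(t), π(t))`
the identities `∫ [p ∂ₑλ_δ(c - ·) + D³Φ_δ(c - ·)(e)(w, w)] = 0` for all `δ = 1/(n+1)`, centres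
`c` and directions `e` (`λ_δ = ΔΦ_δ`, `Φ_δ = newtonReg δ`), whence
(`LocalPressureOscillationSlab.lean`) the mollified pressure `q_δ = λ_δ ⋆ p` satisfies on
`B_r(x₀)` the identity `q_δ(c) - κ'_δ = -N_δ(c) + p_far(c)` with the regularised near field
`N_δ(c) = ∫ D²Φ_δ(c - y)(W y, W y) dy`, `W = 1_{B_{2r}(x₀)} w`, and constants `κ'_δ`. The sibling
file turns this into an oscillation *estimate* (Fatou); here we identify the *limit*:

* `ae_tendsto_nearField_neg_normalisedPressure` — **the regularised near field converges a.e. to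
  minus the Riesz-transform pressure**: for a measurable field `W` with `|W|² ∈ L¹ ∩ L^{3/2}`,
  `N_{δₙ}[W](c) → -p̃[W](c)` for a.e. `c` (`p̃ = normalisedPressure`, `-|W|²/3 + p.v.∫ K(c-y)(W y) dy`).
  *Proof.* Split `N_δ` at `|c - y| = δ`: off the closed ball `D²Φ_δ = D²Γ = -K` on the diagonal
  (`hessReg_apply_apply_eq_neg_pressureKernel`), giving minus the truncated singular integral,
  which converges a.e. by Stein's theorem (`ae_exists_hasPressurePV`, proved in the tree); on the
  ball, freezing `W(y)` at `W(c)` gives exactly `|W(c)|²/3` (isotropy,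
  `setIntegral_closedBall_hessReg_const`), with an error `≤ M |B̄₁| ⨍_{B̄(c,δ)} |W⊗W(y) - W⊗W(c)|`
  (`‖D²Φ_δ‖ ≤ M δ⁻³`), which tends to `0` at the Lebesgue points of `y ↦ evalDiag (W y)`.
* `potential_eq_near_sub_far_of_lt` — the near/far splitting of the renormalised potential of
  `LocalPressureOscillationSlab.potential_eq_near_sub_far` at the radii of Lemma 3.4: near ball
  `B_{2r}(x₀)`, `c ∈ B_r(x₀)`, scale `δ < r`.
* `slice_pressure_representation` — **Lemma 3.4 on a slice**: under the slice identities, for a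
  uniformly locally `L²` field `w` with `∫_{B_{2r}(x₀)} |w|³ < ∞` and `p ∈ L¹_loc`, there is a
  constant `κ` with `p = p̃[1_{B_{2r}(x₀)} w] + p_far + κ` a.e. on `B_r(x₀)`
  (`p_far = localPressureFar x₀ r w`), and `κ = limₙ [(λ_{δₙ} ⋆ p)(x₀) + N_{δₙ}(x₀)]`
  (Lebesgue points of `p`, `ae_tendsto_laplacian_newtonReg_convolution`, and the first item).

## Mathlib / tree search

Tree (`lean search 'nearField|slice_pressure|hessReg_apply_apply_eq_neg|ae_exists_hasPressurePV'`):
`exists_eLpNorm_nearField_le`, `ae_tendsto_laplacian_newtonReg_convolution`,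
`laplacian_newtonReg_convolution_add_potential_eq`, `potential_eq_near_sub_far`,
`slice_pressure_oscillation_le` (estimate only, no identification of the limit),
`setIntegral_closedBall_hessReg_const`, `hessReg_apply_apply_eq_neg_pressureKernel`,
`exists_bound_fderiv_fderiv_newtonReg`, `abs_regPressure_sub_le` (the smooth-field version of the
first item), `ae_exists_hasPressurePV`, `normalisedPressure_eq`, `evalDiag`, `norm_evalDiag_le`,
`integrable_evalDiag_fderiv2_newtonReg_sub`, `evalDiag_fderiv2_newtonReg_sub_eq`,
`localPressureFar`. Mathlib: `IsUnifLocDoublingMeasure.ae_tendsto_average_norm_sub`,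
`Measure.addHaar_closedBall'`, `integral_add_compl`, `tendsto_nhds_unique`.

## References

* K. Kang, H. Miura, T.-P. Tsai, *Short time regularity of Navier–Stokes flows with locally `L³`
  initial data and applications*, IMRN 2021 = arXiv:1812.10509, Lemma 3.4 (p. 8) and §8
  (pp. 17–18: `p_loc`, `p_far`, "`∇p̄_{x₀,R} = ∇p̄_{y₀,r}` on `B_R(x₀) ∩ B_r(y₀)`").
  [`KangMiuraTsai2020`]
* E. M. Stein, *Singular integrals and differentiability properties of functions* (1970),
  Ch. II §4.5 Thm. 4. [`Stein1971`]
-/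

noncomputable section

open MeasureTheory Set Filter Topology Function Metric
open scoped ENNReal NNReal RealInnerProductSpace Laplacian Convolution

namespace Literature.Analysis.FluidPDE

-- nested operator types `ℝ³ →L[ℝ] ℝ³ →L[ℝ] ℝ³ →L[ℝ] ℝ`
set_option maxSynthPendingDepth 3

/-! ## §1. The regularised near field converges to minus the Riesz-transform pressure -/

section NearField

variable {W : EuclideanSpace ℝ (Fin 3) → EuclideanSpace ℝ (Fin 3)} {δ : ℝ}

/-- The near-field integrand `y ↦ D²Φ_δ(a - y)(W y, W y)` is integrable when `|W|² ∈ L¹`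
(`‖D²Φ_δ‖ ≤ δ⁻³ M`). [folklore] -/
theorem integrable_evalDiag_fderiv2_newtonReg (hδ : 0 < δ) (hW : AEStronglyMeasurable W volume)
    (hWi : Integrable (fun y => ‖W y‖ ^ 2) volume) (a : EuclideanSpace ℝ (Fin 3)) :
    Integrable (fun y => evalDiag (W y) (fderiv ℝ (fderiv ℝ (newtonReg δ)) (a - y))) volume := by
  obtain ⟨M, hM0, hM⟩ := exists_bound_fderiv_fderiv_newtonReg
  refine Integrable.mono' (hWi.mul_const (δ⁻¹ ^ 3 * M)) (aestronglyMeasurable_evalDiag_apply hW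
    (((contDiff_fderiv2_newtonReg δ).continuous.comp
      (continuous_const.sub continuous_id)).aestronglyMeasurable))
    (Eventually.of_forall fun y => ?_)
  calc ‖evalDiag (W y) (fderiv ℝ (fderiv ℝ (newtonReg δ)) (a - y))‖
      ≤ ‖evalDiag (W y)‖ * ‖fderiv ℝ (fderiv ℝ (newtonReg δ)) (a - y)‖ :=
        ContinuousLinearMap.le_opNorm _ _
    _ ≤ ‖W y‖ ^ 2 * (δ⁻¹ ^ 3 * M) :=
        mul_le_mul (norm_evalDiag_le _) (hM δ hδ _) (norm_nonneg _) (by positivity)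

/-- **Off the closed ball the near-field integral is minus the truncated singular integral:**
`∫_{|c-y|>δ} D²Φ_δ(c - y)(W y, W y) dy = -∫_{|c-y|>δ} K(c - y)(W y) dy`. [folklore] -/
theorem setIntegral_compl_closedBall_evalDiag_fderiv2_newtonReg (hδ : 0 < δ)
    (c : EuclideanSpace ℝ (Fin 3)) :
    ∫ y in (closedBall c δ)ᶜ, evalDiag (W y) (fderiv ℝ (fderiv ℝ (newtonReg δ)) (c - y)) =
      -truncatedPressureIntegral W c δ := by
  rw [truncatedPressureIntegral, ← integral_neg]
  refine setIntegral_congr_fun measurableSet_closedBall.compl fun y hy => ?_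
  rw [evalDiag_apply]
  exact hessReg_apply_apply_eq_neg_pressureKernel hδ hy (W y)

/-- **On the closed ball, freezing the field at the centre:**
`∫_{|c-y|≤δ} D²Φ_δ(c - y)(W y, W y) dy = |W c|²/3 + ∫_{|c-y|≤δ} D²Φ_δ(c - y)[(W y)^{⊗2} - (W c)^{⊗2}] dy`
(isotropy `∫_{|z|≤δ} D²Φ_δ(z)(a,a) dz = |a|²/3`). [folklore] -/
theorem setIntegral_closedBall_evalDiag_fderiv2_newtonReg (hδ : 0 < δ)
    (hW : AEStronglyMeasurable W volume) (hWi : Integrable (fun y => ‖W y‖ ^ 2) volume)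
    (c : EuclideanSpace ℝ (Fin 3)) :
    ∫ y in closedBall c δ, evalDiag (W y) (fderiv ℝ (fderiv ℝ (newtonReg δ)) (c - y)) =
      ‖W c‖ ^ 2 / 3 + ∫ y in closedBall c δ,
        (evalDiag (W y) - evalDiag (W c)) (fderiv ℝ (fderiv ℝ (newtonReg δ)) (c - y)) := by
  have hcont : Continuous fun y : EuclideanSpace ℝ (Fin 3) =>
      evalDiag (W c) (fderiv ℝ (fderiv ℝ (newtonReg δ)) (c - y)) :=
    (evalDiag (W c)).continuous.comp
      ((contDiff_fderiv2_newtonReg δ).continuous.comp (continuous_const.sub continuous_id))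
  have h0 : IntegrableOn (fun y => evalDiag (W c) (fderiv ℝ (fderiv ℝ (newtonReg δ)) (c - y)))
      (closedBall c δ) volume :=
    hcont.continuousOn.integrableOn_compact (isCompact_closedBall _ _)
  have h1 : IntegrableOn (fun y => evalDiag (W y) (fderiv ℝ (fderiv ℝ (newtonReg δ)) (c - y)))
      (closedBall c δ) volume :=
    (integrable_evalDiag_fderiv2_newtonReg hδ hW hWi c).integrableOn
  have hfreeze : ∫ y in closedBall c δ, evalDiag (W c) (fderiv ℝ (fderiv ℝ (newtonReg δ)) (c - y)) =
      ‖W c‖ ^ 2 / 3 := by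
    simp only [evalDiag_apply]
    exact setIntegral_closedBall_hessReg_const hδ c (W c)
  have h2 : IntegrableOn (fun y => (evalDiag (W y) - evalDiag (W c))
      (fderiv ℝ (fderiv ℝ (newtonReg δ)) (c - y))) (closedBall c δ) volume := by
    refine (h1.sub h0).congr_fun (fun y _ => ?_) measurableSet_closedBall
    simp only [Pi.sub_apply, _root_.sub_apply]
  rw [← hfreeze, ← integral_add h0 h2]
  refine integral_congr_ae (Eventually.of_forall fun y => ?_)
  simp only [_root_.sub_apply]
  ring

/-- **The regularised near field converges a.e. to minus the Riesz-transform pressure.** For a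
measurable field `W` with `|W|² ∈ L¹ ∩ L^{3/2}(ℝ³)` and `δₙ = 1/(n+1)`,
`N_{δₙ}[W](c) = ∫ D²Φ_{δₙ}(c - y)(W y, W y) dy → -p̃[W](c)` for a.e. `c`, where
`p̃[W] = normalisedPressure W = -|W|²/3 + p.v.∫ K(· - y)(W y) dy` (off the ball the kernel is
`-K`, and the truncated singular integrals converge a.e. by Stein's theorem; on the ball the
frozen integral is `|W(c)|²/3` and the rest vanishes in the limit at Lebesgue points of
`W ⊗ W`). [cite: KangMiuraTsai2020, Lemma 3.4 (π_loc) with §8, arXiv:1812.10509 pp. 8, 18] -/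
theorem ae_tendsto_nearField_neg_normalisedPressure (hW : AEStronglyMeasurable W volume)
    (hWi : Integrable (fun y => ‖W y‖ ^ 2) volume)
    (hW2 : MemLp (fun y => ‖W y‖ ^ 2) (3 / 2) volume) :
    ∀ᵐ c : EuclideanSpace ℝ (Fin 3), Tendsto (fun n : ℕ =>
      ∫ y, evalDiag (W y) (fderiv ℝ (fderiv ℝ (newtonReg ((n : ℝ) + 1)⁻¹)) (c - y)))
        atTop (𝓝 (-normalisedPressure W c)) := by
  obtain ⟨M, hM0, hM⟩ := exists_bound_fderiv_fderiv_newtonReg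
  set dn : ℕ → ℝ := fun n => ((n : ℝ) + 1)⁻¹ with hdn
  have hdn0 : ∀ n, 0 < dn n := fun n => by positivity
  have hdlim : Tendsto dn atTop (𝓝[>] 0) := by
    refine tendsto_nhdsWithin_iff.2 ⟨?_, Eventually.of_forall fun n => hdn0 n⟩
    exact tendsto_one_div_add_atTop_nhds_zero_nat.congr fun n => by simp [hdn]
  set V : ℝ := (volume (closedBall (0 : EuclideanSpace ℝ (Fin 3)) 1)).toReal with hV
  -- the tensor `y ↦ evalDiag (W y)` is integrable
  set g : EuclideanSpace ℝ (Fin 3) →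
      ((EuclideanSpace ℝ (Fin 3) →L[ℝ] EuclideanSpace ℝ (Fin 3) →L[ℝ] ℝ) →L[ℝ] ℝ) :=
    fun y => evalDiag (W y) with hg
  have hgm : AEStronglyMeasurable g volume := continuous_evalDiag.comp_aestronglyMeasurable hW
  have hgi : Integrable g volume :=
    Integrable.mono' hWi hgm (Eventually.of_forall fun y => norm_evalDiag_le _)
  have hLeb := IsUnifLocDoublingMeasure.ae_tendsto_average_norm_sub (μ := volume)
    hgi.locallyIntegrable 1
  -- the principal values exist a.e. (Stein)
  have h32 : (1 : ℝ≥0∞) < 3 / 2 := by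
    rw [ENNReal.lt_div_iff_mul_lt (Or.inl two_ne_zero) (Or.inl ENNReal.ofNat_ne_top)]; norm_num
  have h32t : (3 / 2 : ℝ≥0∞) < ⊤ := ENNReal.div_lt_top ENNReal.ofNat_ne_top two_ne_zero
  have hPV := ae_exists_hasPressurePV h32 h32t hW hW2
  filter_upwards [hLeb, hPV] with c hc hL'
  obtain ⟨L, hL⟩ := hL'
  have hav := hc (fun _ : ℕ => c) dn hdlim (Eventually.of_forall fun n => by
    rw [one_mul]; exact mem_closedBall_self (hdn0 n).le)
  -- the value of the normalised pressure at `c`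
  have hnp : normalisedPressure W c = -‖W c‖ ^ 2 / 3 + L := by
    rw [normalisedPressure_eq hL, finrank_euclideanSpace_fin]
    push_cast
    ring
  -- the truncated singular integrals converge along `dn`
  have hT : Tendsto (fun n => truncatedPressureIntegral W c (dn n)) atTop (𝓝 L) := hL.2.comp hdlim
  -- the error on the ball
  set err : ℕ → ℝ := fun n => ∫ y in closedBall c (dn n),
    (evalDiag (W y) - evalDiag (W c)) (fderiv ℝ (fderiv ℝ (newtonReg (dn n))) (c - y)) with herr
  have hdec : ∀ n, ∫ y, evalDiag (W y) (fderiv ℝ (fderiv ℝ (newtonReg (dn n))) (c - y)) =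
      ‖W c‖ ^ 2 / 3 + err n - truncatedPressureIntegral W c (dn n) := by
    intro n
    rw [← integral_add_compl (measurableSet_closedBall (x := c) (ε := dn n))
      (integrable_evalDiag_fderiv2_newtonReg (hdn0 n) hW hWi c),
      setIntegral_closedBall_evalDiag_fderiv2_newtonReg (hdn0 n) hW hWi c,
      setIntegral_compl_closedBall_evalDiag_fderiv2_newtonReg (hdn0 n) c]
    ring
  have herr_le : ∀ n, ‖err n‖ ≤ M * V * ⨍ y in closedBall c (dn n), ‖g y - g c‖ := by
    intro n
    have hI : ∫ y in closedBall c (dn n), ‖g y - g c‖ =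
        V * (dn n) ^ 3 * ⨍ y in closedBall c (dn n), ‖g y - g c‖ := by
      rw [setAverage_eq, smul_eq_mul, measureReal_def,
        Measure.addHaar_closedBall' volume c (hdn0 n).le, finrank_euclideanSpace_fin,
        ENNReal.toReal_mul, ENNReal.toReal_ofReal (by positivity), hV]
      have hV0 : (volume (closedBall (0 : EuclideanSpace ℝ (Fin 3)) 1)).toReal ≠ 0 :=
        ENNReal.toReal_ne_zero.2 ⟨(measure_closedBall_pos volume _ one_pos).ne',
          measure_closedBall_lt_top.ne⟩
      have hd0 : (dn n) ^ 3 ≠ 0 := by positivity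
      have hd0' : dn n ≠ 0 := (hdn0 n).ne'
      field_simp
    have hpt : ∀ y ∈ closedBall c (dn n),
        ‖(evalDiag (W y) - evalDiag (W c)) (fderiv ℝ (fderiv ℝ (newtonReg (dn n))) (c - y))‖ ≤
          (dn n)⁻¹ ^ 3 * M * ‖g y - g c‖ := by
      intro y _
      calc ‖(evalDiag (W y) - evalDiag (W c)) (fderiv ℝ (fderiv ℝ (newtonReg (dn n))) (c - y))‖
          ≤ ‖evalDiag (W y) - evalDiag (W c)‖ * ‖fderiv ℝ (fderiv ℝ (newtonReg (dn n))) (c - y)‖ :=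
            ContinuousLinearMap.le_opNorm _ _
        _ ≤ ‖g y - g c‖ * ((dn n)⁻¹ ^ 3 * M) :=
            mul_le_mul_of_nonneg_left (hM _ (hdn0 n) _) (norm_nonneg _)
        _ = (dn n)⁻¹ ^ 3 * M * ‖g y - g c‖ := by ring
    have hgc : IntegrableOn (fun y => ‖g y - g c‖) (closedBall c (dn n)) volume :=
      (hgi.integrableOn.sub (integrableOn_const measure_closedBall_lt_top.ne)).norm
    calc ‖err n‖ ≤ ∫ y in closedBall c (dn n), (dn n)⁻¹ ^ 3 * M * ‖g y - g c‖ :=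
          norm_integral_le_of_norm_le (hgc.const_mul _)
            ((ae_restrict_iff' measurableSet_closedBall).2 (Eventually.of_forall hpt))
      _ = (dn n)⁻¹ ^ 3 * M * (V * (dn n) ^ 3 * ⨍ y in closedBall c (dn n), ‖g y - g c‖) := by
          rw [integral_const_mul, hI]
      _ = M * V * ⨍ y in closedBall c (dn n), ‖g y - g c‖ := by
          have hd0 : dn n ≠ 0 := (hdn0 n).ne'
          field_simp
  have herr0 : Tendsto err atTop (𝓝 0) := by
    have hlim : Tendsto (fun n => M * V * ⨍ y in closedBall c (dn n), ‖g y - g c‖) atTop (𝓝 0) := by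
      have := hav.const_mul (M * V)
      rwa [mul_zero] at this
    exact squeeze_zero_norm herr_le hlim
  have hfin := (tendsto_const_nhds (x := ‖W c‖ ^ 2 / 3) |>.add herr0).sub hT
  rw [add_zero] at hfin
  rw [hnp, show -(-‖W c‖ ^ 2 / 3 + L) = ‖W c‖ ^ 2 / 3 - L by ring]
  exact hfin.congr fun n => (hdec n).symm

end NearField

/-! ## §2. The near/far splitting at the radii of Lemma 3.4 -/

section Split

variable {w : EuclideanSpace ℝ (Fin 3) → EuclideanSpace ℝ (Fin 3)} {A : ℝ≥0∞} {δ : ℝ}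

/-- **The near/far splitting of the renormalised potential at the radii of Lemma 3.4.** For
`S = B_{2r}(x₀)`, `0 < δ < r`, `c ∈ B_r(x₀)`, and a uniformly locally `L²` field `w` with
`|1_S w|² ∈ L¹`: `𝒢_δ(c) = N_δ(c) - N_δ(x₀) - p_far(c)`, where
`𝒢_δ(c) = ∫ (D²Φ_δ(c-y) - D²Φ_δ(x₀-y))(w, w)`, `N_δ(c) = ∫ D²Φ_δ(c-y)(1_S w, 1_S w)` is the
regularised near field and `p_far = localPressureFar x₀ r w` the far field of the local
pressure expansion (off `S`, `|c - y| > r > δ` and `D²Φ_δ = -K` on the diagonal). The tree's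
`potential_eq_near_sub_far` is the case `δ ≤ 1`, `S = B_{2k}(x₀)` with `r + 1 ≤ k`.
[cite: KangMiuraTsai2020, Lemma 3.4 (π_far), arXiv:1812.10509 p. 8] -/
theorem potential_eq_near_sub_far_of_lt (hw : AEStronglyMeasurable w volume) (hAtop : A ≠ ⊤)
    (hA : ∀ z : EuclideanSpace ℝ (Fin 3), ∫⁻ y in ball z 1, ‖w y‖ₑ ^ 2 ≤ A) (hδ : 0 < δ)
    (x₀ : EuclideanSpace ℝ (Fin 3)) {r : ℝ} (hδr : δ < r)
    (hWi : Integrable (fun y => ‖(ball x₀ (2 * r)).indicator w y‖ ^ 2) volume)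
    {c : EuclideanSpace ℝ (Fin 3)} (hc : c ∈ ball x₀ r) :
    ∫ y, evalDiag (w y) (fderiv ℝ (fderiv ℝ (newtonReg δ)) (c - y) -
        fderiv ℝ (fderiv ℝ (newtonReg δ)) (x₀ - y)) =
      (∫ y, evalDiag ((ball x₀ (2 * r)).indicator w y) (fderiv ℝ (fderiv ℝ (newtonReg δ)) (c - y))) -
        (∫ y, evalDiag ((ball x₀ (2 * r)).indicator w y) (fderiv ℝ (fderiv ℝ (newtonReg δ)) (x₀ - y))) -
        localPressureFar x₀ r (fun _ => w) 0 c := by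
  set S : Set (EuclideanSpace ℝ (Fin 3)) := ball x₀ (2 * r) with hS
  set W : EuclideanSpace ℝ (Fin 3) → EuclideanSpace ℝ (Fin 3) := S.indicator w with hW
  set H : EuclideanSpace ℝ (Fin 3) → EuclideanSpace ℝ (Fin 3) →L[ℝ] EuclideanSpace ℝ (Fin 3) →L[ℝ] ℝ :=
    fderiv ℝ (fderiv ℝ (newtonReg δ)) with hH
  have hint := integrable_evalDiag_fderiv2_newtonReg_sub hδ hw hAtop hA x₀ c
  rw [← integral_add_compl (measurableSet_ball (x := x₀) (ε := 2 * r)) hint]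
  -- integrability of `y ↦ H(a - y)(W y, W y)` for every `a`
  have hWm : AEStronglyMeasurable W volume := hw.indicator measurableSet_ball
  have hIa : ∀ a : EuclideanSpace ℝ (Fin 3), Integrable (fun y => evalDiag (W y) (H (a - y))) volume :=
    fun a => integrable_evalDiag_fderiv2_newtonReg hδ hWm hWi a
  -- the near part
  have hnear : ∫ y in S, evalDiag (w y) (H (c - y) - H (x₀ - y)) =
      (∫ y, evalDiag (W y) (H (c - y))) - ∫ y, evalDiag (W y) (H (x₀ - y)) := by
    rw [← integral_sub (hIa c) (hIa x₀)]
    have h1 : ∫ y in S, evalDiag (w y) (H (c - y) - H (x₀ - y)) =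
        ∫ y in S, evalDiag (W y) (H (c - y) - H (x₀ - y)) :=
      setIntegral_congr_fun measurableSet_ball fun y hy => by rw [hW, indicator_of_mem hy]
    rw [h1, setIntegral_eq_integral_of_forall_compl_eq_zero fun y hy => by
      rw [hW, indicator_of_notMem hy]; simp]
    refine integral_congr_ae (Eventually.of_forall fun y => ?_)
    simp only [map_sub]
  -- the far part
  have hfar : ∫ y in Sᶜ, evalDiag (w y) (H (c - y) - H (x₀ - y)) =
      -localPressureFar x₀ r (fun _ => w) 0 c := by
    rw [localPressureFar_apply, ← integral_neg]
    refine setIntegral_congr_fun measurableSet_ball.compl fun y hy => ?_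
    have hy' : 2 * r ≤ ‖y - x₀‖ := by
      rw [mem_compl_iff, mem_ball, dist_eq_norm, not_lt] at hy; exact hy
    have hcx : ‖c - x₀‖ < r := by rw [← dist_eq_norm]; exact hc
    have h1 : δ < ‖c - y‖ := by
      have : ‖y - x₀‖ ≤ ‖y - c‖ + ‖c - x₀‖ := norm_sub_le_norm_sub_add_norm_sub _ _ _
      rw [norm_sub_rev y c] at this
      linarith
    have h2 : δ < ‖x₀ - y‖ := by rw [norm_sub_rev]; linarith
    rw [hH, evalDiag_fderiv2_newtonReg_sub_eq hδ h1 h2]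
  rw [hnear, hfar]
  ring

end Split

/-! ## §3. The slice representation (Lemma 3.4 on a time slice) -/

section Slice

variable {w : EuclideanSpace ℝ (Fin 3) → EuclideanSpace ℝ (Fin 3)} {A : ℝ≥0∞}
  {p : EuclideanSpace ℝ (Fin 3) → ℝ}

/-- **The local pressure expansion on a slice (Kang–Miura–Tsai 2021, Lemma 3.4, slice form).**
Let `w` be a measurable, uniformly locally `L²` field, `p ∈ L¹_loc(ℝ³)`, and suppose the slice
identities `∫ [p(x) ∂ₑλ_δ(c - x) + D³Φ_δ(c - x)(e)(w x, w x)] dx = 0` hold for every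
`δ = 1/(n+1)`, every centre `c` and every direction `e` (the output of the Liouville step,
`IsLocalLeraySolutionOn.ae_slice_pgIdentity`). Then for every ball `B_r(x₀)` with
`∫_{B_{2r}(x₀)} |w|³ < ∞` there is a constant `κ` with

  `p = p̃[1_{B_{2r}(x₀)} w] + p_far + κ`  a.e. on `B_r(x₀)`,

`p̃ = normalisedPressure` (`-|w|²/3 + p.v.∫_{B_{2r}(x₀)} K(·-y):(w ⊗ w) dy` on `B_{2r}(x₀)`),
`p_far = localPressureFar x₀ r w` (`∫_{|y-x₀|≥2r} (K(·-y) - K(x₀-y)):(w ⊗ w) dy`); moreover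
`κ = limₙ [(λ_{δₙ} ⋆ p)(x₀) + N_{δₙ}(x₀)]`, `N_δ` the regularised near field. *Proof.* The
mollified pressure `q_δ = λ_δ ⋆ p` satisfies `q_δ(c) - κ'_δ = -N_δ(c) + p_far(c)` on `B_r(x₀)`
for `δ < r` (`laplacian_newtonReg_convolution_add_potential_eq`, `potential_eq_near_sub_far_of_lt`);
as `δₙ → 0`, `q_{δₙ} → p` a.e. (Lebesgue points) and `N_{δₙ} → -p̃[1_{B_{2r}} w]` a.e.
(`ae_tendsto_nearField_neg_normalisedPressure`), so the constants converge and the identity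
passes to the limit.
[cite: KangMiuraTsai2020, Lemma 3.4 (pressure decomposition), arXiv:1812.10509 p. 8; proof §8 pp. 17–18] -/
theorem slice_pressure_representation (hw : AEStronglyMeasurable w volume) (hAtop : A ≠ ⊤)
    (hA : ∀ z : EuclideanSpace ℝ (Fin 3), ∫⁻ y in ball z 1, ‖w y‖ₑ ^ 2 ≤ A)
    (hp : LocallyIntegrable p volume)
    (hid : ∀ (n : ℕ) (c e : EuclideanSpace ℝ (Fin 3)),
      ∫ x, (p x * fderiv ℝ (Δ (newtonReg ((n : ℝ) + 1)⁻¹)) (c - x) e +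
        evalDiag (w x) (fderiv ℝ (fderiv ℝ (fderiv ℝ (newtonReg ((n : ℝ) + 1)⁻¹))) (c - x) e)) = 0)
    (x₀ : EuclideanSpace ℝ (Fin 3)) {r : ℝ} (hr : 0 < r)
    (hI3 : ∫⁻ y in ball x₀ (2 * r), ‖w y‖ₑ ^ (3 : ℕ) ≠ ⊤) :
    ∃ κ : ℝ,
      Tendsto (fun n : ℕ => (Δ (newtonReg ((n : ℝ) + 1)⁻¹) ⋆[ContinuousLinearMap.lsmul ℝ ℝ, volume] p) x₀ +
        ∫ y, evalDiag ((ball x₀ (2 * r)).indicator w y)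
          (fderiv ℝ (fderiv ℝ (newtonReg ((n : ℝ) + 1)⁻¹)) (x₀ - y))) atTop (𝓝 κ) ∧
      ∀ᵐ c ∂(volume.restrict (ball x₀ r)),
        p c = normalisedPressure ((ball x₀ (2 * r)).indicator w) c +
          localPressureFar x₀ r (fun _ => w) 0 c + κ := by
  -- radii and sets
  set S : Set (EuclideanSpace ℝ (Fin 3)) := ball x₀ (2 * r) with hS
  set Br : Set (EuclideanSpace ℝ (Fin 3)) := ball x₀ r with hBr
  set μr : Measure (EuclideanSpace ℝ (Fin 3)) := volume.restrict Br with hμr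
  set I3 : ℝ≥0∞ := ∫⁻ y in S, ‖w y‖ₑ ^ (3 : ℕ) with hI3def
  -- the truncated field `W = 1_S w`
  set W : EuclideanSpace ℝ (Fin 3) → EuclideanSpace ℝ (Fin 3) := S.indicator w with hW
  have hWm : AEStronglyMeasurable W volume := hw.indicator measurableSet_ball
  have hWS : ∀ x, x ∉ S → W x = 0 := fun x hx => by rw [hW, indicator_of_notMem hx]
  have hW3 : ∫⁻ y, ‖(‖W y‖ ^ 2 : ℝ)‖ₑ ^ (3 / 2 : ℝ) = I3 := by
    rw [hI3def, ← lintegral_indicator measurableSet_ball]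
    refine lintegral_congr fun y => ?_
    rw [enorm_norm_sq_rpow_threeHalves, hW]
    by_cases hy : y ∈ S
    · rw [indicator_of_mem hy, indicator_of_mem hy]
    · rw [indicator_of_notMem hy, indicator_of_notMem hy]
      simp
  have hW2 : MemLp (fun x => ‖W x‖ ^ 2) (3 / 2) volume := by
    refine ⟨(continuous_norm.pow 2).comp_aestronglyMeasurable hWm, ?_⟩
    exact eLpNorm_threeHalves_lt_top_of_lintegral (by rw [hW3]; exact hI3)
  have hWi : Integrable (fun y => ‖W y‖ ^ 2) volume := by
    have h32 : (1 : ℝ≥0∞) ≤ 3 / 2 := by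
      rw [ENNReal.le_div_iff_mul_le (Or.inl two_ne_zero) (Or.inl ENNReal.ofNat_ne_top)]; norm_num
    haveI : IsFiniteMeasure ((volume : Measure (EuclideanSpace ℝ (Fin 3))).restrict (closedBall x₀ (2 * r))) :=
      ⟨by rw [Measure.restrict_apply_univ]; exact measure_closedBall_lt_top⟩
    have h1 : IntegrableOn (fun y => ‖W y‖ ^ 2) (closedBall x₀ (2 * r)) volume :=
      (hW2.restrict _).integrable h32
    exact h1.integrable_of_forall_notMem_eq_zero fun y hy => by
      simp [hWS y fun h => hy (ball_subset_closedBall h)]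
  -- scales, mollified pressures, near fields, far field
  set dn : ℕ → ℝ := fun n => ((n : ℝ) + 1)⁻¹ with hdn
  have hdn0 : ∀ n, 0 < dn n := fun n => by positivity
  have hdlim0 : Tendsto dn atTop (𝓝 0) :=
    tendsto_one_div_add_atTop_nhds_zero_nat.congr fun n => by simp [hdn]
  set q : ℕ → EuclideanSpace ℝ (Fin 3) → ℝ := fun n =>
    Δ (newtonReg (dn n)) ⋆[ContinuousLinearMap.lsmul ℝ ℝ, volume] p with hq
  set N : ℕ → EuclideanSpace ℝ (Fin 3) → ℝ := fun n c =>
    ∫ y, evalDiag (W y) (fderiv ℝ (fderiv ℝ (newtonReg (dn n))) (c - y)) with hN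
  set LPF : EuclideanSpace ℝ (Fin 3) → ℝ := fun c => localPressureFar x₀ r (fun _ => w) 0 c with hLPF
  set κ' : ℕ → ℝ := fun n => q n x₀ + N n x₀ with hκ'
  -- (1) the key identity on `B_r(x₀)`, for `δₙ < r`
  have hkey : ∀ n, dn n < r → ∀ c ∈ Br, q n c - κ' n = -N n c + LPF c := by
    intro n hn c hc
    have hcst := laplacian_newtonReg_convolution_add_potential_eq hw hAtop hA hp (hdn0 n)
      (fun c e => hid n c e) x₀ c
    have hsplit := potential_eq_near_sub_far_of_lt (A := A) hw hAtop hA (hdn0 n) x₀ hn hWi hc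
    rw [hsplit] at hcst
    simp only [hκ', hq, hN, hLPF]
    linarith
  have hev : ∀ᶠ n in atTop, dn n < r := hdlim0.eventually_lt_const hr
  -- (2) a.e. convergence of the mollified pressures and of the near fields on `B_r(x₀)`
  have hq_ae : ∀ᵐ c ∂μr, Tendsto (fun n => q n c) atTop (𝓝 (p c)) :=
    ae_restrict_of_ae (ae_tendsto_laplacian_newtonReg_convolution hp)
  have hN_ae : ∀ᵐ c ∂μr, Tendsto (fun n => N n c) atTop (𝓝 (-normalisedPressure W c)) :=
    ae_restrict_of_ae (ae_tendsto_nearField_neg_normalisedPressure hWm hWi hW2)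
  -- (3) one good point determines the limit of the constants
  have hμr0 : μr ≠ 0 := by
    rw [hμr, Ne, Measure.restrict_eq_zero]
    exact (measure_ball_pos volume x₀ hr).ne'
  haveI : (ae μr).NeBot := ae_neBot.2 hμr0
  obtain ⟨c₀, hc₀, hq₀, hN₀⟩ := ((ae_restrict_mem measurableSet_ball).and (hq_ae.and hN_ae)).exists
  set κ : ℝ := p c₀ - normalisedPressure W c₀ - LPF c₀ with hκdef
  have hκ : Tendsto κ' atTop (𝓝 κ) := by
    have h1 : Tendsto (fun n => q n c₀ + N n c₀ - LPF c₀) atTop (𝓝 (p c₀ + -normalisedPressure W c₀ - LPF c₀)) :=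
      (hq₀.add hN₀).sub tendsto_const_nhds
    rw [hκdef, show p c₀ - normalisedPressure W c₀ - LPF c₀ =
      p c₀ + -normalisedPressure W c₀ - LPF c₀ by ring]
    refine h1.congr' ?_
    filter_upwards [hev] with n hn
    have := hkey n hn c₀ hc₀
    linarith
  refine ⟨κ, hκ, ?_⟩
  -- (4) the identity in the limit at a.e. point of `B_r(x₀)`
  filter_upwards [ae_restrict_mem measurableSet_ball, hq_ae, hN_ae] with c hc hqc hNc
  have h2 : Tendsto (fun n => κ' n - N n c + LPF c) atTop
      (𝓝 (κ - -normalisedPressure W c + LPF c)) := (hκ.sub hNc).add tendsto_const_nhds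
  have h3 : Tendsto (fun n => q n c) atTop (𝓝 (κ - -normalisedPressure W c + LPF c)) := by
    refine h2.congr' ?_
    filter_upwards [hev] with n hn
    have := hkey n hn c hc
    linarith
  have := tendsto_nhds_unique hqc h3
  rw [this]
  ring

end Slice


end Literature.Analysis.FluidPDE
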